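import Literature.Barriers.Parity.SiegelZeroDichotomyProofs
import HarnessLib
import Summits.Parity.GeneralizedHardyLittlewood.Theorems.UnboundedSiegelZeros

/-!
# Linnik's exponent `3 + ε` in the presence of a Siegel zero (Heath-Brown 1990, as restated in
# Heath-Brown 1992)

Topic `Literature/NumberTheory/LFunctions` (namespace `Literature.NumberTheory.LFunctions`). Typed
for the cell `parity-realchar` (SIEGEL INSTRUMENT, deliverable (3) «illusory-world conditionals»,
topic I.2 «primes in arithmetic progressions / Linnik's constant», want W1 of the list of record).
ONE named fact and PROVED readings.

## Source and provenance (disclosed)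

PRIMARY: D. R. Heath-Brown, *Siegel zeros and the least prime in an arithmetic progression*, Quart.
J. Math. Oxford (2) 41 (1990) 405–418 [HeathBrown1990SiegelLinnik] — NOT HELD (acquisition request
acq-11150, open). The fact is typed from the AUTHOR'S OWN RESTATEMENT in the held D. R. Heath-Brown,
*Zero-free regions for Dirichlet `L`-functions, and the least prime in an arithmetic progression*,
Proc. London Math. Soc. (3) 64 (1992) 265–338 [HeathBrown1992PLMS] (`paper:doi-10-1112-plms-s3-64-2-265`),
§1, the paragraph following Theorem 6 and (1.3)–(1.4) (held text layer p0006:L1–8), verbatim: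

  "Another conditional result, which will be of importance to us, is that of Heath-Brown [14]. Here
  one assumes that the exceptional zero of Principle 1 does indeed exist, and is `1 − λ/log q` say.
  One then has `P(a, q) ≪_ε q^{3+ε}`, providing that `λ ≤ λ(ε)`. It follows that, for the purposes
  of proving Theorem 6, one may assume that `λ ≫ 1`. [...] Moreover the result of Heath-Brown [14]
  is effective, so that the constant in our Theorem 6 is also effectively computable."

with "[14] D.R. Heath-Brown, 'Siegel zeros and the least prime in an arithmetic progression', Quart.
J. Math. Oxford Ser. (2), 41 (1990), 405-418" (reference list), `P(a, q)` = the least prime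
`p ≡ a (mod q)`, `(a, q) = 1` (§1, opening paragraph: "how big is the first such prime, `P(a, q)`
say?"), and Principle 1 (§1):
"`∏_{χ (mod q)} L(s, χ)` (1.2) has at most one zero in the region `σ ≥ 1 − c₁/log q(2 + |t|)`. Such
a zero, if it exists, is real and simple, and corresponds to a non-principal real character." This
is the same precedent as `heathBrown1983_theorem1` (Heath-Brown 1983 typed from Tao–Teräväinen's
restatement, `HeathBrownPrimeTwinsSiegelZeros.lean`): a restatement by the same author in a refereed
paper, the primary's page to be diffed by the referee when acq-11150 is fulfilled. The survey
paraphrase «`L < 3` under a Siegel zero» (Iwaniec 2006) is NOT used as a locator.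

## How it is typed

* `heathBrown1990_leastPrime` — NAMED FACT: for every `ε > 0` there are `λ(ε) > 0` and an
  (effective) `C(ε) > 0` such that for every modulus `q ≥ 1`, every non-principal real (quadratic)
  character `χ mod q` and every real `λ` with `0 < λ ≤ λ(ε)` and `L(1 − λ/log q, χ) = 0`, every
  reduced class `a mod q` contains a prime `p ≤ C q^{3+ε}`. The hypothesis «the exceptional zero of
  Principle 1 exists and is `1 − λ/log q`» is rendered by its content (a real zero of a non-principal
  real `L`-function mod `q` at `1 − λ/log q`); uniqueness/simplicity (automatic in Principle 1's
  region) is not needed to STATE the implication and is not assumed — the typed hypothesis is weaker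
  only in wording (any such zero with `λ ≤ λ(ε) ≤ c₁` IS the exceptional zero of Principle 1), so the
  typed fact is implied by print.
* PROVED readings on the column's predicate (Tao–Teräväinen's quality `η`: `β = 1 − 1/(η log q)`, so
  `λ = 1/η`): `IsSiegelZero.leastPrime_le_of_heathBrown1990` — for every `ε > 0` there are `η₀(ε)`
  and `C(ε)` such that every Siegel zero of quality `η ≥ η₀` attached to `χ mod q` forces
  `P(a, q) ≤ C q^{3+ε}` for all `(a, q) = 1`; `UnboundedSiegelZeros.leastPrime_frequently` — in the
  illusory world (`UnboundedSiegelZeros`) the bound `P(a,q) ≤ C(ε) q^{3+ε}` holds for all classes to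
  arbitrarily large moduli `q`. Compare: unconditionally `L = 5` (Xylouris 2011,
  `xylouris2011_theorem21`, `q ≥ q₀`), `L = 2 − 1/59` under Friedlander–Iwaniec's far stronger
  exceptionality `L(1,χ) ≤ (log D)^{−1−r^r}` and only for `D^r ≤ q ≤ exp(L(1,χ)^{−1/(r^r+1)})`
  (`FriedlanderIwaniec2003_linnik`), and `L = 2 + ε` on GRH.

Index only ([HeathBrown1992PLMS], section «Proof of Theorem 6; Siegel Zeros», held text layer p0085):
"Thus Linnik's constant may be taken as `4.9` in the 'Siegel Zero' case" (inside the proof of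
Theorem 6, case `λ₁ < 0.348`) — an intermediate statement, not typed.

LABEL (cell rule): instrument / statement layer. WHAT THIS IS NOT: no claim that an exceptional
zero exists; `λ(ε)` and `C(ε)` are not printed numerically (effective in principle); nothing here
bears on the parity summit.

## References

* [HeathBrown1990SiegelLinnik] D. R. Heath-Brown, Quart. J. Math. Oxford (2) 41 (1990) 405–418 —
  the theorem (primary NOT held, acq-11150).
* [HeathBrown1992PLMS] D. R. Heath-Brown, PLMS (3) 64 (1992) 265–338 — §1: opening paragraph
  (`P(a,q)`), Principle 1, the paragraph after Theorem 6 (the restatement of [14]); reference [14].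
* [TaoTeravainen2021] T. Tao, J. Teräväinen, JLMS 106 (2022), Definition 1.4 (quality `η`).
-/

noncomputable section

open Literature.Barriers.Parity

namespace Literature.NumberTheory.LFunctions

/-- **Heath-Brown 1990 (NAMED FACT, as restated by the author in Heath-Brown 1992, §1, after Theorem 6).**
"Here one assumes that the exceptional zero of Principle 1 does indeed exist, and is `1 − λ/log q`
say. One then has `P(a, q) ≪_ε q^{3+ε}`, providing that `λ ≤ λ(ε)`." — with `P(a,q)` the least
prime `p ≡ a (mod q)`, `(a,q) = 1`, and the exceptional zero of Principle 1 a real zero of `L(s,χ)`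
for a non-principal real character `χ mod q`; "the result of Heath-Brown [14] is effective".
Rendered: for every `ε > 0` there are `λ(ε) > 0` and `C(ε) > 0` such that for every `q ≥ 1`, every
non-principal quadratic `χ mod q`, every `0 < λ ≤ λ(ε)` with `L(1 − λ/log q, χ) = 0` and every `a`
coprime to `q` there is a prime `p ≡ a (mod q)` with `p ≤ C q^{3+ε}`. Typed from the restatement;
the primary (Quart. J. Math. 41 (1990) 405–418) is not held (acq-11150). Not proved here.
[cite: HeathBrown1990SiegelLinnik, main theorem (as restated in Heath-Brown 1992, §1, paragraph after Theorem 6)]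
[cite: HeathBrown1992PLMS, §1 (restatement of [14] after Theorem 6; Principle 1; P(a,q))] -/
def heathBrown1990_leastPrime : Prop :=
  ∀ ε : ℝ, 0 < ε → ∃ lam₀ : ℝ, 0 < lam₀ ∧ ∃ C : ℝ, 0 < C ∧
    ∀ (q : ℕ) [NeZero q] (χ : DirichletCharacter ℂ q), χ ≠ 1 → χ.IsQuadratic →
      ∀ lam : ℝ, 0 < lam → lam ≤ lam₀ → χ.LFunction ((1 - lam / Real.log q : ℝ) : ℂ) = 0 →
        ∀ a : ℕ, a.Coprime q →
          ∃ p : ℕ, p.Prime ∧ p ≡ a [MOD q] ∧ (p : ℝ) ≤ C * (q : ℝ) ^ (3 + ε)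

/-! ### Readings on the column's predicate (PROVED modulo the named fact) -/

/-- A primitive character of modulus `q ≥ 2` is non-trivial. [folklore] -/
private theorem isPrimitive_ne_one_aux {q : ℕ} [NeZero q] (hq : 2 ≤ q)
    {χ : DirichletCharacter ℂ q} (hχ : χ.IsPrimitive) : χ ≠ 1 := by
  intro h1
  rw [DirichletCharacter.isPrimitive_def, h1, DirichletCharacter.conductor_one] at hχ
  omega

/-- **Siegel zero of large quality ⇒ Linnik exponent `3 + ε` for that modulus** (modulo
`heathBrown1990_leastPrime`): for every `ε > 0` there are `η₀(ε)` and `C(ε) > 0` such that for every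
Siegel zero of quality `η ≥ η₀` (Tao–Teräväinen: `χ` primitive quadratic mod `q`,
`L(1 − 1/(η log q), χ) = 0`; here `λ = 1/η ≤ λ(ε)`) and every `a` coprime to `q` there is a prime
`p ≡ a (mod q)`, `p ≤ C q^{3+ε}`.
[cite: HeathBrown1990SiegelLinnik, main theorem (as restated in Heath-Brown 1992, §1, paragraph after Theorem 6)]
[cite: TaoTeravainen2021, Definition 1.4] -/
theorem _root_.Literature.Barriers.Parity.IsSiegelZero.leastPrime_le_of_heathBrown1990
    (h : heathBrown1990_leastPrime) {ε : ℝ} (hε : 0 < ε) :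
    ∃ η₀ : ℝ, 0 < η₀ ∧ ∃ C : ℝ, 0 < C ∧
      ∀ (q : ℕ) [NeZero q] (χ : DirichletCharacter ℂ q) (η : ℝ), IsSiegelZero χ η → η₀ ≤ η →
        ∀ a : ℕ, a.Coprime q →
          ∃ p : ℕ, p.Prime ∧ p ≡ a [MOD q] ∧ (p : ℝ) ≤ C * (q : ℝ) ^ (3 + ε) := by
  obtain ⟨lam₀, hlam₀, C, hC, hmain⟩ := h ε hε
  refine ⟨1 / lam₀, by positivity, C, hC, fun q _ χ η hS hη a ha => ?_⟩
  have hq3 : 3 ≤ q := hS.three_le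
  obtain ⟨hprim, hquad, h10, hzero⟩ := hS
  have hηpos : 0 < η := by linarith
  have hne : χ ≠ 1 := isPrimitive_ne_one_aux (by omega) hprim
  -- `λ = 1/η`: `0 < λ ≤ λ₀` and `1 − λ/log q = 1 − 1/(η log q)`
  have hlam : 1 / η ≤ lam₀ := by
    rw [div_le_iff₀ hηpos]
    have := (div_le_iff₀ hlam₀).mp hη
    linarith
  have heq : (1 - (1 / η) / Real.log q : ℝ) = 1 - 1 / (η * Real.log q) := by
    rw [div_div]
  refine hmain q χ hne hquad (1 / η) (by positivity) hlam ?_ a ha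
  rw [heq]
  exact hzero

/-- **In the illusory world the Linnik exponent is `3 + ε` along a sequence of moduli** (modulo
`heathBrown1990_leastPrime`): under `UnboundedSiegelZeros`, for every `ε > 0` there is `C(ε) > 0`
such that for every `q₀` some modulus `q ≥ q₀` has `P(a, q) ≤ C q^{3+ε}` for ALL `a` coprime to
`q`. (Unconditionally print has `L = 5` for `q ≥ q₀`, Xylouris 2011.)
[cite: HeathBrown1990SiegelLinnik, main theorem (as restated in Heath-Brown 1992, §1, paragraph after Theorem 6)]
[cite: TaoTeravainen2021, Definition 1.4 and §1.1 (the hypothesis "Siegel zeros exist")] -/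
theorem _root_.Literature.Barriers.Parity.UnboundedSiegelZeros.leastPrime_frequently
    (h : heathBrown1990_leastPrime) (hU : Summit.Parity.GeneralizedHardyLittlewood.UnboundedSiegelZeros) {ε : ℝ} (hε : 0 < ε) :
    ∃ C : ℝ, 0 < C ∧ ∀ q₀ : ℕ, ∃ (q : ℕ) (_ : NeZero q), q₀ ≤ q ∧
      ∀ a : ℕ, a.Coprime q → ∃ p : ℕ, p.Prime ∧ p ≡ a [MOD q] ∧ (p : ℝ) ≤ C * (q : ℝ) ^ (3 + ε) := by
  obtain ⟨η₀, _, C, hC, hmain⟩ := IsSiegelZero.leastPrime_le_of_heathBrown1990 h hε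
  refine ⟨C, hC, fun q₀ => ?_⟩
  obtain ⟨q, hq, χ, η, hq₀, hη₀, hS⟩ := hU η₀ q₀
  exact ⟨q, hq, hq₀, fun a ha => hmain q χ η hS hη₀ a ha⟩

end Literature.NumberTheory.LFunctions

end
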